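import Mathlib.CategoryTheory.Limits.Shapes.Pullback.PullbackCone
import Mathlib.CategoryTheory.Limits.Shapes.BinaryProducts
import Mathlib.CategoryTheory.Limits.Shapes.Terminal
import Mathlib.CategoryTheory.EpiMono
import HarnessLib

/-!
# Semi-graphs of anabelioids, Appendix, proof of Theorem A.4 (Čech route to the existence half):
# the pullback squares of the two-term Čech nerve `(X ⨯ A) ⨯ A ⇉ X ⨯ A` — pure category theory

Mochizuki, *Semi-graphs of anabelioids*, Publ. RIMS **42** (2006) 221–322, Appendix, Theorem A.4
(manuscript pp. 82–86) [cite: MochizukiSemiAnbd2006, Thm A.4 pp.82-86].  The abc-iut cell proves the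
EXISTENCE half of Thm. A.4 for the model quasi-temperoids `B^temp(Πᵢ)[Aᵢ]` by the Čech construction
`ψ^*(X) := coeq(F((X ⨯ A₂) ⨯ A₂) ⇉ F(X ⨯ A₂))` (row A4-∃ of `plan/L3/SUBDAG-SemiAnbd-Cor311.md`,
holder abc-iut-w5-d129, seat map 2026-08-26T03:40Z).  This file is the slot «E1 (iv) — nerve
pullback squares» (seat abc-iut-w4-d048): the finite-limit bookkeeping about the pair

  `k₁ := prod.fst : (X ⨯ A) ⨯ A ⟶ X ⨯ A`,  `k₂ := prod.map prod.fst (𝟙 A) : (X ⨯ A) ⨯ A ⟶ X ⨯ A`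

that the finite-limit preservation of `ψ^*` (file E3, `QuasiTemperoidsThmA4CechLimits`) consumes,
in ANY category with the relevant finite limits (so that E3 instantiates it at `B^temp(Π₂)` and, the
squares being limits of nonempty connected shape, inside `B^temp(Π₂)[A₂]`):

* `CechSq.P A X := X ⨯ A`, `CechSq.K A X := (X ⨯ A) ⨯ A`, `CechSq.k₁`, `CechSq.k₂`, and on arrows
  `CechSq.mapP`, `CechSq.mapK` (reducible abbreviations of the holder's spec terms, nothing new);
* the RELATION maps: diagonal `CechSq.δ : P ⟶ K` (reflexivity), swap `CechSq.σ : K ⟶ K` (symmetry),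
  and the transitivity square `CechSq.isLimit_trans` (`((X ⨯ A) ⨯ A) ⨯ A` is `K ×_{k₂, P, k₁} K`) with
  the composition map `CechSq.m₃`;
* (iv-a) `CechSq.isLimit_sq₁`, `CechSq.isLimit_sq₂`: for `u : Y ⟶ Z`, `K Y` is the pullback
  `P Y ×_{P Z, kᵢ} K Z` (`i = 1, 2`);
* (iv-b) `CechSq.mono_lift_k₁_k₂`: `(k₁, k₂) : K Z ⟶ P Z ⨯ P Z` is a (split) monomorphism;
* (iv-c) `CechSq.isLimit_P_pullback`, `CechSq.isLimit_K_pullback`: `P` and `K` carry pullback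
  squares to pullback squares;
* (iv-d) `CechSq.isIso_lift_k₁_k₂_terminal`: for `X = ⊤`, `(k₁, k₂) : K ⊤ ⟶ P ⊤ ⨯ P ⊤` is an isomorphism.

Pure category theory (no `B^temp`, no temperedness); nothing refers to the IUT corpus; no side is
taken on any disputed claim.
-/

open CategoryTheory CategoryTheory.Limits

noncomputable section

namespace Literature.AnabelianGeometry.SemiGraphs

namespace CechSq

universe v₁ u₁

variable {C : Type u₁} [Category.{v₁} C] [HasBinaryProducts C] (A : C)

/-! ### The objects and the two arrows -/

/-- `P X := X ⨯ A` (the object `X × A₂ ∈ T₂[A₂]` of the Čech route). [cite: MochizukiSemiAnbd2006, Thm A.4 pp.82-86] -/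
abbrev P (X : C) : C := X ⨯ A

/-- `K X := (X ⨯ A) ⨯ A` (the object `X × A₂ × A₂`). [cite: MochizukiSemiAnbd2006, Thm A.4 pp.82-86] -/
abbrev K (X : C) : C := (X ⨯ A) ⨯ A

/-- `k₁ : (X ⨯ A) ⨯ A ⟶ X ⨯ A`, `((x, a), a′) ↦ (x, a)`. [cite: MochizukiSemiAnbd2006, Thm A.4 pp.82-86] -/
abbrev k₁ (X : C) : K A X ⟶ P A X := prod.fst

/-- `k₂ : (X ⨯ A) ⨯ A ⟶ X ⨯ A`, `((x, a), a′) ↦ (x, a′)`. [cite: MochizukiSemiAnbd2006, Thm A.4 pp.82-86] -/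
abbrev k₂ (X : C) : K A X ⟶ P A X := prod.map prod.fst (𝟙 A)

/-- `P` on arrows: `u ⨯ A`. [cite: MochizukiSemiAnbd2006, Thm A.4 pp.82-86] -/
abbrev mapP {Y Z : C} (u : Y ⟶ Z) : P A Y ⟶ P A Z := prod.map u (𝟙 A)

/-- `K` on arrows: `(u ⨯ A) ⨯ A`. [cite: MochizukiSemiAnbd2006, Thm A.4 pp.82-86] -/
abbrev mapK {Y Z : C} (u : Y ⟶ Z) : K A Y ⟶ K A Z := prod.map (prod.map u (𝟙 A)) (𝟙 A)

/-- The two arrows have the same composite to `X`: `k₁ ≫ pr_X = k₂ ≫ pr_X`.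
[cite: MochizukiSemiAnbd2006, Thm A.4 pp.82-86] -/
@[reassoc] theorem k₁_fst (X : C) : k₁ A X ≫ prod.fst = k₂ A X ≫ prod.fst := by
  simp only [k₁, k₂, prod.map_fst]

/-- `k₁` is natural. [cite: MochizukiSemiAnbd2006, Thm A.4 pp.82-86] -/
@[reassoc] theorem mapK_k₁ {Y Z : C} (u : Y ⟶ Z) : mapK A u ≫ k₁ A Z = k₁ A Y ≫ mapP A u := by
  simp only [mapK, k₁, mapP, prod.map_fst]

/-- `k₂` is natural. [cite: MochizukiSemiAnbd2006, Thm A.4 pp.82-86] -/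
@[reassoc] theorem mapK_k₂ {Y Z : C} (u : Y ⟶ Z) : mapK A u ≫ k₂ A Z = k₂ A Y ≫ mapP A u := by
  simp only [mapK, k₂, mapP, prod.map_map, prod.map_fst, Category.comp_id]

/-! ### The relation maps: reflexivity, symmetry, transitivity -/

/-- The diagonal `δ : X ⨯ A ⟶ (X ⨯ A) ⨯ A`, `(x, a) ↦ ((x, a), a)` (reflexivity of the Čech relation).
[cite: MochizukiSemiAnbd2006, Thm A.4 pp.82-86] -/
abbrev δ (X : C) : P A X ⟶ K A X := prod.lift (𝟙 _) prod.snd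

/-- `δ ≫ k₁ = 𝟙`. [cite: MochizukiSemiAnbd2006, Thm A.4 pp.82-86] -/
@[reassoc] theorem δ_k₁ (X : C) : δ A X ≫ k₁ A X = 𝟙 _ := by
  simp only [δ, k₁, prod.lift_fst]

/-- `δ ≫ k₂ = 𝟙`. [cite: MochizukiSemiAnbd2006, Thm A.4 pp.82-86] -/
@[reassoc] theorem δ_k₂ (X : C) : δ A X ≫ k₂ A X = 𝟙 _ := by
  simp only [δ, k₂, prod.lift_map, Category.id_comp, Category.comp_id, prod.lift_fst_snd]

/-- The swap `σ : (X ⨯ A) ⨯ A ⟶ (X ⨯ A) ⨯ A`, `((x, a), a′) ↦ ((x, a′), a)` (symmetry of the relation).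
[cite: MochizukiSemiAnbd2006, Thm A.4 pp.82-86] -/
abbrev σ (X : C) : K A X ⟶ K A X := prod.lift (k₂ A X) (prod.fst ≫ prod.snd)

/-- `σ ≫ k₁ = k₂`. [cite: MochizukiSemiAnbd2006, Thm A.4 pp.82-86] -/
@[reassoc] theorem σ_k₁ (X : C) : σ A X ≫ k₁ A X = k₂ A X := by
  simp only [σ, k₁, prod.lift_fst]

/-- `σ ≫ k₂ = k₁`. [cite: MochizukiSemiAnbd2006, Thm A.4 pp.82-86] -/
@[reassoc] theorem σ_k₂ (X : C) : σ A X ≫ k₂ A X = k₁ A X := by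
  apply prod.hom_ext <;>
  simp only [P, K, k₁, k₂, σ, prod.lift_fst, prod.lift_snd, prod.lift_map, prod.map_fst,
    Category.comp_id]

/-- `KK X := ((X ⨯ A) ⨯ A) ⨯ A` (the object `X × A³` carrying transitivity). [cite: MochizukiSemiAnbd2006, Thm A.4 pp.82-86] -/
abbrev KK (X : C) : C := ((X ⨯ A) ⨯ A) ⨯ A

/-- `m₁ : ((X ⨯ A) ⨯ A) ⨯ A ⟶ (X ⨯ A) ⨯ A`, `(((x, a), a′), a″) ↦ ((x, a), a′)`. [cite: MochizukiSemiAnbd2006, Thm A.4 pp.82-86] -/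
abbrev m₁ (X : C) : KK A X ⟶ K A X := prod.fst

/-- `m₂ : ((X ⨯ A) ⨯ A) ⨯ A ⟶ (X ⨯ A) ⨯ A`, `(((x, a), a′), a″) ↦ ((x, a′), a″)`. [cite: MochizukiSemiAnbd2006, Thm A.4 pp.82-86] -/
abbrev m₂ (X : C) : KK A X ⟶ K A X := prod.map (k₂ A X) (𝟙 A)

/-- `m₃ : ((X ⨯ A) ⨯ A) ⨯ A ⟶ (X ⨯ A) ⨯ A`, `(((x, a), a′), a″) ↦ ((x, a), a″)` (the composition of the
relation). [cite: MochizukiSemiAnbd2006, Thm A.4 pp.82-86] -/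
abbrev m₃ (X : C) : KK A X ⟶ K A X := prod.map (k₁ A X) (𝟙 A)

/-- The transitivity square commutes: `m₁ ≫ k₂ = m₂ ≫ k₁`. [cite: MochizukiSemiAnbd2006, Thm A.4 pp.82-86] -/
@[reassoc] theorem m₁_k₂ (X : C) : m₁ A X ≫ k₂ A X = m₂ A X ≫ k₁ A X := by
  simp only [m₁, m₂, k₁, k₂, prod.map_fst]

/-- `m₃ ≫ k₁ = m₁ ≫ k₁`. [cite: MochizukiSemiAnbd2006, Thm A.4 pp.82-86] -/
@[reassoc] theorem m₃_k₁ (X : C) : m₃ A X ≫ k₁ A X = m₁ A X ≫ k₁ A X := by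
  simp only [m₃, m₁, k₁, prod.map_fst]

/-- `m₃ ≫ k₂ = m₂ ≫ k₂`. [cite: MochizukiSemiAnbd2006, Thm A.4 pp.82-86] -/
@[reassoc] theorem m₃_k₂ (X : C) : m₃ A X ≫ k₂ A X = m₂ A X ≫ k₂ A X := by
  simp only [m₃, m₂, k₁, k₂, prod.map_map, prod.map_fst]

/-- **The transitivity square is a pullback**: `((X ⨯ A) ⨯ A) ⨯ A` with `m₁`, `m₂` is
`K X ×_{k₂, P X, k₁} K X` (lift `(v, w) ↦ (v, pr_A w)`). [cite: MochizukiSemiAnbd2006, Thm A.4 pp.82-86] -/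
def isLimit_trans (X : C) :
    IsLimit (PullbackCone.mk (m₁ A X) (m₂ A X) (m₁_k₂ A X)) :=
  PullbackCone.IsLimit.mk _
    (fun s => prod.lift s.fst (s.snd ≫ prod.snd))
    (fun s => by simp only [m₁, prod.lift_fst])
    (fun s => by
      have h := s.condition
      simp only [P, K, k₁, k₂] at h
      apply prod.hom_ext
      · simpa only [P, K, k₁, k₂, mapP, mapK, δ, σ, KK, m₁, m₂, m₃, prod.lift_fst,
        prod.lift_snd, prod.lift_fst_assoc, prod.lift_snd_assoc, prod.lift_map,
        prod.map_fst, prod.map_snd, prod.map_fst_assoc, prod.map_snd_assoc,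
        prod.comp_lift, prod.lift_fst_snd, prod.map_map, Category.assoc, Category.comp_id,
        Category.id_comp] using h
      · simp only [P, K, k₁, k₂, KK, m₂, prod.lift_snd, prod.lift_map, Category.comp_id])
    (fun s m hm₁ hm₂ => by
      have e₂ := congrArg (· ≫ prod.snd) hm₂
      simp only [P, K, k₁, k₂, KK, m₁, m₂, prod.map_snd, Category.assoc,
        Category.comp_id] at hm₁ e₂
      apply prod.hom_ext
      · simpa only [prod.lift_fst, prod.lift_snd, prod.lift_fst_assoc,
        prod.lift_snd_assoc, prod.lift_map, prod.map_fst, prod.map_snd,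
        prod.map_fst_assoc, prod.map_snd_assoc, prod.comp_lift, prod.lift_fst_snd,
        prod.map_map, Category.assoc, Category.comp_id, Category.id_comp] using hm₁
      · simpa only [prod.lift_fst, prod.lift_snd, prod.lift_fst_assoc,
        prod.lift_snd_assoc, prod.lift_map, prod.map_fst, prod.map_snd,
        prod.map_fst_assoc, prod.map_snd_assoc, prod.comp_lift, prod.lift_fst_snd,
        prod.map_map, Category.assoc, Category.comp_id, Category.id_comp] using e₂)

/-! ### (iv-a) The naturality squares of `k₁`, `k₂` are pullbacks -/

variable {A}

/-- **(iv-a), `i = 1`**: for `u : Y ⟶ Z`, `(Y ⨯ A) ⨯ A` with `k₁` and `(u ⨯ A) ⨯ A` is the pullback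
`(Y ⨯ A) ×_{Z ⨯ A, k₁} ((Z ⨯ A) ⨯ A)` (lift `(v, w) ↦ (v, pr_A w)`). [cite: MochizukiSemiAnbd2006, Thm A.4 pp.82-86] -/
def isLimit_sq₁ {Y Z : C} (u : Y ⟶ Z) :
    IsLimit (PullbackCone.mk (k₁ A Y) (mapK A u) (mapK_k₁ A u).symm :
      PullbackCone (mapP A u) (k₁ A Z)) :=
  PullbackCone.IsLimit.mk _
    (fun s => prod.lift s.fst (s.snd ≫ prod.snd))
    (fun s => by simp only [k₁, prod.lift_fst])
    (fun s => by
      have h := s.condition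
      simp only [P, K, k₁, mapP] at h
      apply prod.hom_ext
      · simpa only [P, K, k₁, k₂, mapP, mapK, δ, σ, KK, m₁, m₂, m₃, prod.lift_fst,
        prod.lift_snd, prod.lift_fst_assoc, prod.lift_snd_assoc, prod.lift_map,
        prod.map_fst, prod.map_snd, prod.map_fst_assoc, prod.map_snd_assoc,
        prod.comp_lift, prod.lift_fst_snd, prod.map_map, Category.assoc, Category.comp_id,
        Category.id_comp] using h
      · simp only [P, K, k₁, mapP, mapK, prod.lift_snd, prod.lift_map, Category.comp_id])
    (fun s m hm₁ hm₂ => by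
      have e₂ := congrArg (· ≫ prod.snd) hm₂
      simp only [P, K, k₁, mapP, mapK, prod.map_snd, Category.assoc, Category.comp_id] at hm₁ e₂
      apply prod.hom_ext
      · simpa only [prod.lift_fst, prod.lift_snd, prod.lift_fst_assoc,
        prod.lift_snd_assoc, prod.lift_map, prod.map_fst, prod.map_snd,
        prod.map_fst_assoc, prod.map_snd_assoc, prod.comp_lift, prod.lift_fst_snd,
        prod.map_map, Category.assoc, Category.comp_id, Category.id_comp] using hm₁
      · simpa only [prod.lift_fst, prod.lift_snd, prod.lift_fst_assoc,
        prod.lift_snd_assoc, prod.lift_map, prod.map_fst, prod.map_snd,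
        prod.map_fst_assoc, prod.map_snd_assoc, prod.comp_lift, prod.lift_fst_snd,
        prod.map_map, Category.assoc, Category.comp_id, Category.id_comp] using e₂)

/-- **(iv-a), `i = 2`**: for `u : Y ⟶ Z`, `(Y ⨯ A) ⨯ A` with `k₂` and `(u ⨯ A) ⨯ A` is the pullback
`(Y ⨯ A) ×_{Z ⨯ A, k₂} ((Z ⨯ A) ⨯ A)` (lift `((y, a), ((z, a′), a″)) ↦ ((y, a′), a)`).
[cite: MochizukiSemiAnbd2006, Thm A.4 pp.82-86] -/
def isLimit_sq₂ {Y Z : C} (u : Y ⟶ Z) :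
    IsLimit (PullbackCone.mk (k₂ A Y) (mapK A u) (mapK_k₂ A u).symm :
      PullbackCone (mapP A u) (k₂ A Z)) :=
  PullbackCone.IsLimit.mk _
    (fun s => prod.lift (prod.lift (s.fst ≫ prod.fst) (s.snd ≫ prod.fst ≫ prod.snd))
      (s.fst ≫ prod.snd))
    (fun s => by
      apply prod.hom_ext <;>
      simp only [P, K, k₂, mapP, prod.lift_fst, prod.lift_snd, prod.lift_map, Category.comp_id])
    (fun s => by
      have h₁ := congrArg (· ≫ prod.fst) s.condition
      have h₂ := congrArg (· ≫ prod.snd) s.condition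
      simp only [P, K, k₂, mapP, prod.map_fst, prod.map_snd, Category.assoc,
        Category.comp_id] at h₁ h₂
      apply prod.hom_ext
      · apply prod.hom_ext
        · simpa only [P, K, k₁, k₂, mapP, mapK, δ, σ, KK, m₁, m₂, m₃, prod.lift_fst,
          prod.lift_snd, prod.lift_fst_assoc, prod.lift_snd_assoc, prod.lift_map,
          prod.map_fst, prod.map_snd, prod.map_fst_assoc, prod.map_snd_assoc,
          prod.comp_lift, prod.lift_fst_snd, prod.map_map, Category.assoc,
          Category.comp_id, Category.id_comp] using h₁
        · simp only [P, K, k₂, mapP, mapK, prod.lift_fst, prod.lift_snd, prod.lift_map,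
          Category.assoc, Category.comp_id]
      · simpa only [P, K, k₁, k₂, mapP, mapK, δ, σ, KK, m₁, m₂, m₃, prod.lift_fst,
        prod.lift_snd, prod.lift_fst_assoc, prod.lift_snd_assoc, prod.lift_map,
        prod.map_fst, prod.map_snd, prod.map_fst_assoc, prod.map_snd_assoc,
        prod.comp_lift, prod.lift_fst_snd, prod.map_map, Category.assoc,
        Category.comp_id, Category.id_comp] using h₂)
    (fun s m hm₁ hm₂ => by
      have e₁ := congrArg (· ≫ prod.fst) hm₁
      have e₂ := congrArg (· ≫ prod.snd) hm₁
      have e₃ := congrArg (· ≫ prod.fst ≫ prod.snd) hm₂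
      simp only [P, K, k₂, mapP, mapK, prod.map_fst, prod.map_snd, prod.map_fst_assoc,
        Category.assoc, Category.comp_id] at e₁ e₂ e₃
      apply prod.hom_ext
      · apply prod.hom_ext
        · simpa only [prod.lift_fst, prod.lift_snd, prod.lift_fst_assoc,
          prod.lift_snd_assoc, prod.lift_map, prod.map_fst, prod.map_snd,
          prod.map_fst_assoc, prod.map_snd_assoc, prod.comp_lift, prod.lift_fst_snd,
          prod.map_map, Category.assoc, Category.comp_id, Category.id_comp] using e₁
        · simpa only [prod.lift_fst, prod.lift_snd, prod.lift_fst_assoc,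
          prod.lift_snd_assoc, prod.lift_map, prod.map_fst, prod.map_snd,
          prod.map_fst_assoc, prod.map_snd_assoc, prod.comp_lift, prod.lift_fst_snd,
          prod.map_map, Category.assoc, Category.comp_id, Category.id_comp] using e₃
      · simpa only [prod.lift_fst, prod.lift_snd, prod.lift_fst_assoc,
        prod.lift_snd_assoc, prod.lift_map, prod.map_fst, prod.map_snd,
        prod.map_fst_assoc, prod.map_snd_assoc, prod.comp_lift, prod.lift_fst_snd,
        prod.map_map, Category.assoc, Category.comp_id, Category.id_comp] using e₂)

/-! ### (iv-b) `(k₁, k₂)` is a monomorphism -/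

/-- **(iv-b)**: `(k₁, k₂) : (Z ⨯ A) ⨯ A ⟶ (Z ⨯ A) ⨯ (Z ⨯ A)` is a split monomorphism (retraction
`𝟙 ⨯ pr_A`), hence a monomorphism. [cite: MochizukiSemiAnbd2006, Thm A.4 pp.82-86] -/
theorem isSplitMono_lift_k₁_k₂ (Z : C) : IsSplitMono (prod.lift (k₁ A Z) (k₂ A Z)) :=
  IsSplitMono.mk' ⟨prod.map (𝟙 _) prod.snd, by
    simp only [P, K, k₁, k₂, prod.lift_map, prod.map_snd, prod.lift_fst_snd, Category.comp_id]⟩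

/-- **(iv-b)**: `(k₁, k₂)` is a monomorphism. [cite: MochizukiSemiAnbd2006, Thm A.4 pp.82-86] -/
theorem mono_lift_k₁_k₂ (Z : C) : Mono (prod.lift (k₁ A Z) (k₂ A Z)) := by
  haveI := isSplitMono_lift_k₁_k₂ (A := A) Z
  infer_instance

/-! ### (iv-c) `P` and `K` preserve pullback squares -/

/-- The square of `P`-images of a commutative square commutes. [cite: MochizukiSemiAnbd2006, Thm A.4 pp.82-86] -/
theorem mapP_sq {X Y Z : C} {f : X ⟶ Z} {g : Y ⟶ Z} (c : PullbackCone f g) :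
    mapP A c.fst ≫ mapP A f = mapP A c.snd ≫ mapP A g := by
  simp only [mapP, prod.map_map, c.condition]

/-- **(iv-c) for `P`**: `− ⨯ A` carries a pullback square to a pullback square (products commute with
fibre products). [cite: MochizukiSemiAnbd2006, Thm A.4 pp.82-86] -/
def isLimit_P_pullback {X Y Z : C} {f : X ⟶ Z} {g : Y ⟶ Z} (c : PullbackCone f g)
    (hc : IsLimit c) :
    IsLimit (PullbackCone.mk (mapP A c.fst) (mapP A c.snd) (mapP_sq c) :
      PullbackCone (mapP A f) (mapP A g)) :=
  PullbackCone.IsLimit.mk _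
    (fun s => prod.lift
      (PullbackCone.IsLimit.lift hc (s.fst ≫ prod.fst) (s.snd ≫ prod.fst) (by
        have h₁ := congrArg (· ≫ prod.fst) s.condition
        simpa only [P, K, k₁, k₂, mapP, mapK, δ, σ, KK, m₁, m₂, m₃, prod.lift_fst,
          prod.lift_snd, prod.lift_fst_assoc, prod.lift_snd_assoc, prod.lift_map,
          prod.map_fst, prod.map_snd, prod.map_fst_assoc, prod.map_snd_assoc,
          prod.comp_lift, prod.lift_fst_snd, prod.map_map, Category.assoc,
          Category.comp_id, Category.id_comp] using h₁))
      (s.fst ≫ prod.snd))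
    (fun s => by
      apply prod.hom_ext <;>
      simp only [P, mapP, prod.lift_fst, prod.lift_snd, prod.lift_map, Category.comp_id,
        PullbackCone.IsLimit.lift_fst])
    (fun s => by
      have h₂ := congrArg (· ≫ prod.snd) s.condition
      simp only [P, mapP, prod.map_snd, Category.assoc, Category.comp_id] at h₂
      apply prod.hom_ext
      · simp only [P, mapP, prod.lift_fst, prod.lift_map, Category.comp_id,
        PullbackCone.IsLimit.lift_snd]
      · simpa only [P, K, k₁, k₂, mapP, mapK, δ, σ, KK, m₁, m₂, m₃, prod.lift_fst,
        prod.lift_snd, prod.lift_fst_assoc, prod.lift_snd_assoc, prod.lift_map,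
        prod.map_fst, prod.map_snd, prod.map_fst_assoc, prod.map_snd_assoc,
        prod.comp_lift, prod.lift_fst_snd, prod.map_map, Category.assoc,
        Category.comp_id, Category.id_comp] using h₂)
    (fun s m hm₁ hm₂ => by
      have e₁ := congrArg (· ≫ prod.fst) hm₁
      have e₂ := congrArg (· ≫ prod.snd) hm₁
      have e₃ := congrArg (· ≫ prod.fst) hm₂
      simp only [P, mapP, prod.map_fst, prod.map_snd, Category.assoc,
        Category.comp_id] at e₁ e₂ e₃
      apply prod.hom_ext
      · rw [prod.lift_fst]
        apply PullbackCone.IsLimit.hom_ext hc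
        · rw [PullbackCone.IsLimit.lift_fst, Category.assoc]
          exact e₁
        · rw [PullbackCone.IsLimit.lift_snd, Category.assoc]
          exact e₃
      · simpa only [prod.lift_fst, prod.lift_snd, prod.lift_fst_assoc,
        prod.lift_snd_assoc, prod.lift_map, prod.map_fst, prod.map_snd,
        prod.map_fst_assoc, prod.map_snd_assoc, prod.comp_lift, prod.lift_fst_snd,
        prod.map_map, Category.assoc, Category.comp_id, Category.id_comp] using e₂)

/-- **(iv-c) for `K`**: `(− ⨯ A) ⨯ A` carries a pullback square to a pullback square.
[cite: MochizukiSemiAnbd2006, Thm A.4 pp.82-86] -/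
def isLimit_K_pullback {X Y Z : C} {f : X ⟶ Z} {g : Y ⟶ Z} (c : PullbackCone f g)
    (hc : IsLimit c) :
    IsLimit (PullbackCone.mk (mapK A c.fst) (mapK A c.snd)
      (mapP_sq (PullbackCone.mk (mapP A c.fst) (mapP A c.snd) (mapP_sq c))) :
      PullbackCone (mapK A f) (mapK A g)) :=
  isLimit_P_pullback (A := A) _ (isLimit_P_pullback (A := A) c hc)

/-! ### (iv-d) Over the terminal object `(k₁, k₂)` is an isomorphism -/

/-- **(iv-d)**: for `X = ⊤`, `(k₁, k₂) : (⊤ ⨯ A) ⨯ A ⟶ (⊤ ⨯ A) ⨯ (⊤ ⨯ A)` is an isomorphism (inverse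
`𝟙 ⨯ pr_A`; two arrows to `⊤` agree). [cite: MochizukiSemiAnbd2006, Thm A.4 pp.82-86] -/
theorem isIso_lift_k₁_k₂_terminal [HasTerminal C] : IsIso (prod.lift (k₁ A (⊤_ C)) (k₂ A (⊤_ C))) := by
  refine ⟨⟨prod.map (𝟙 _) prod.snd, ?_, ?_⟩⟩
  · simp only [P, K, k₁, k₂, prod.lift_map, prod.map_snd, prod.lift_fst_snd, Category.comp_id]
  · apply prod.hom_ext
    · simp only [P, K, k₁, k₂, prod.lift_fst, prod.map_fst, prod.comp_lift, prod.map_map,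
      Category.comp_id, Category.id_comp]
    · apply prod.hom_ext
      · exact terminal.hom_ext _ _
      · simp only [P, K, k₁, k₂, prod.lift_snd, prod.map_fst, prod.map_snd, prod.comp_lift,
        prod.map_map, Category.comp_id, Category.id_comp]

end CechSq

end Literature.AnabelianGeometry.SemiGraphs

end
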